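import Literature.Barriers.ValiantsHypothesis.BILPS19HMinRank1ToHQuadProofs
import HarnessLib

/-!
# Bläser–Ikenmeyer–Lysikov–Pandey–Schreyer 2019, Thm 34, second half: `HQuad ≤ₚ HMinRank1`, and the
# discharge of `BILPS2019_thm34`

Sibling proof file of `BILPS19MembershipHardness.lean` (val-lit X5, §8), continuing
`BILPS19HMinRank1ToHQuadProofs.lean`. BILPS Thm 34 ("`HMinRank1_{K,F}` is polynomial-time
equivalent to `HQuad_{K,F}`", arXiv:1911.02534 p0033:L77) is typed as
`BILPS2019_thm34 F : hmr1Language F ≤ₚ hquadZLanguage F ∧ hquadZLanguage F ≤ₚ hmr1Language F`. The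
first reduction (the printed `2 × 2`-minors map) is the sibling file; this file proves the SECOND,
`hquadZLanguage F ≤ₚ hmr1Language F`, for EVERY field `F`, and assembles **`BILPS2019_thm34_holds`**.

DEVIATION FROM PRINT (disclosed). The printed proof of the second reduction (p0033:L83–L93, with
Thm 32, p0033:L1–L10) linearises: a common zero `x` of the forms `Q_1, …, Q_t` is a nonzero rank-`1`
point `x xᵀ` of the linear subspace `𝒦 = {S ∈ Sym² Fⁿ : ⟨Q_l, S⟩ = 0 ∀ l}`, and the reduction outputs
"slices `B_f`" forming a BASIS of `𝒦`, computed "in polynomial time" by Gaussian elimination over the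
effective field `K`. Exact linear algebra over `ℚ` with bit-size control is not available in the
tree's typed polynomial-time algebra (`CodeFP*.lean` has elimination only over finite prime fields),
so this file realises the same linearisation by a DIFFERENT, elimination-free many-one map, which is
all the typed statement asks (module docstring (2) of the statement file: "polynomial-time
equivalent" is typed as Karp reductions both ways). Instead of solving the linear conditions
"`S` symmetric" and "`⟨Q_l, S⟩ = 0`" for a basis, the map IMPOSES them as extra diagonal entries of the
pencil, which the rank bound forces to vanish:

* §B (the map, `BILPS19Thm34.instB`): for `(n, Q_1..Q_t)` with every `|Q_l| = n²` and `t ≥ 1`, the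
  `HMinRank1` instance with `k = n²` unknowns `y_p` (`p ↔ (i, j) = (p / n, p mod n)`), square slices of
  size `N = n + (t + n²)` and bound `1`, slice `p` being `E_{ij}` on the top-left `n × n` block, the
  entry `Q_l[i,j]` at the diagonal position `n + l`, and `[q = p] − [q = swap p]` at the diagonal
  position `n + t + q` (`swap (i,j) = (j,i)`); so `Σ_p y_p · slice_p = Y ⊕ diag(⟨Q_l, Y⟩)_l ⊕
  diag(Y_q − Y_{swap q})_q` for the GENERAL `n × n` matrix `Y = (y_{(i,j)})` (`BILPS19Thm34.pencilB`,
  entry lemmas `pencilB_inl_inl`, `pencilB_mid`, `pencilB_last`, `pencilB_offDiag`). No forms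
  (`t = 0`): the fixed yes-instance `(0, 1, [], 1)` if `n ≥ 1` (any nonzero `x`), else the fixed
  no-instance; ill-formed coefficient lists: the fixed no-instance `(0, 0, [], 0)`.
* Correctness (`BILPS19Thm34.mem_hquadZSet_iff_reduceB_mem`, every field, no division):
  (⇐) a common zero `v ≠ 0` gives `y_p = v_i v_j`, pencil `= u uᵀ` with `u = (v, 0, 0)`, rank `≤ 1`;
  (⇒) `y ≠ 0` gives `Y_{ab} ≠ 0`; the `2 × 2` minor on rows `{a, d}`, columns `{b, d}` for a diagonal
  position `d ≥ n` forces every `⟨Q_l, Y⟩ = 0` and `Y` symmetric; the minor on rows `{a, i}`,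
  columns `{a, j}` with symmetry gives `Y_{ai} Y_{aj} = Y_{aa} Y_{ij}`, whence for `w :=` row `a` of
  `Y` (`w_b ≠ 0`): `Q_l(w) = Σ Q_l[i,j] Y_{ai} Y_{aj} = Y_{aa} ⟨Q_l, Y⟩ = 0`
  (`exists_common_zero_of_rank_le_one`, `rank_pencilB_le_one_of_common_zero`).
* §N (the machine): `BILPS19Thm34.reduceBFP`, one table in the typed `CodeFP` algebra (nested
  `rawGetOr`, `intOfSM`/`intSub`/`smOfInt`, `brange`/`map` under the unary budget
  `(t + Σ_l |Q_l| + 2)⁴`, which dominates `k N²` when `t ≥ 1` — the case `t = 0` is special-cased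
  precisely because `n` is a binary numeral).
* §T: `BILPS19Thm34.hquadZLanguage_karpReducible_hmr1Language`, via the sibling's generic
  `karpReducible_of_decoder` and decoder `decQ`; **`BILPS2019_thm34_holds`**.

Theorem-only file (its `def`s are proof plumbing: tables and the instance map; no statement of
`BILPS19MembershipHardness.lean` is touched, no new fact). HONEST FRAMING (val-lit): typed
literature; `VP ≠ VNP` is NOT proved and nothing here is progress on it.

## References

* [BlaserIkenmeyerLysikovPandeySchreyer2019] M. Bläser, C. Ikenmeyer, V. Lysikov, A. Pandey,
  F.-O. Schreyer, *Variety membership testing, algebraic natural proofs, and geometric complexity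
  theory*, arXiv:1911.02534, §8.1, Problems 2–4, Thm. 32, Thm. 34 (p0032:L36, p0033:L1–L10,
  L77–L93).
* [AroraBarak2009] S. Arora, B. Barak, *Computational Complexity: A Modern Approach*, CUP 2009,
  Def. 2.7 (Karp reductions), §1.3 (polynomial time: composition, bounded loops), §0.1 (codes).
-/

noncomputable section

namespace Literature.Barriers.ValiantsHypothesis

open Literature.Computability.AlgebraicComplexity Literature.Computability.Complexity
open _root_.Computability
open scoped Literature.Computability.Complexity.Notation

universe u

namespace BILPS19Thm34

open CodeFP Brick CanonCode

/-! ### §B. The elimination-free map `HQuad_ℤ → HMinRank1` and its correctness -/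

section ReductionB

variable (F : Type u) [Field F]

/-- Items of a tabulated list. [folklore] -/
private theorem getD_map_range' (f : ℕ → ℤ) {m s : ℕ} (hs : s < m) : ((List.range m).map f).getD s 0 = f s := by
  rw [List.getD_eq_getElem _ _ (by simpa using hs)]
  simp

/-- Row-major positions decode: `(a k + b) / k = a`, `(a k + b) mod k = b` for `b < k`. [folklore] -/
private theorem rowMajor_div_mod' {k a b : ℕ} (hb : b < k) : (a * k + b) / k = a ∧ (a * k + b) % k = b := by
  have hk : 0 < k := by omega
  constructor
  · rw [Nat.add_comm, Nat.add_mul_div_right _ _ hk, Nat.div_eq_of_lt hb, Nat.zero_add]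
  · rw [Nat.add_comm, Nat.add_mul_mod_self_right, Nat.mod_eq_of_lt hb]

/-- Row-major positions are in range: `a k + b < m k` for `a < m`, `b < k`. [folklore] -/
private theorem rowMajor_lt' {k m a b : ℕ} (ha : a < m) (hb : b < k) : a * k + b < m * k := by
  calc a * k + b < a * k + k := by omega
    _ = (a + 1) * k := by ring
    _ ≤ m * k := Nat.mul_le_mul_right _ ha

/-- The code of the transposed pair: `(i, j) ↦ (j, i)`, i.e. `p ↦ (p mod n) n + p / n`.
[cite: BlaserIkenmeyerLysikovPandeySchreyer2019, Thm. 32 (proof: `Sym²`)] -/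
def swapCode (n p : ℕ) : ℕ := p % n * n + p / n

/-- **Entry `(R, C)` of slice `p` of the output tensor** (`p ↔ (i, j) = (p / n, p mod n)`; `t` forms;
slices of size `N = n + (t + n²)`): `E_{ij}` on the top-left `n × n` block; on the diagonal,
`Q_l[i, j]` at position `n + l` (`l < t`) and `[q = p] − [q = swap p]` at position `n + t + q`;
`0` elsewhere. [cite: BlaserIkenmeyerLysikovPandeySchreyer2019, Thm. 34 (proof)] -/
def sliceEntry (n t : ℕ) (forms : List (List ℤ)) (p R C : ℕ) : ℤ :=
  if decide (R < n) && decide (C < n) then (if decide (R = p / n) && decide (C = p % n) then 1 else 0)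
  else if decide (R = C) then
    (if decide (R < n + t) then (forms.getD (R - n) []).getD p 0
      else (if decide (R - (n + t) = p) then 1 else 0) - (if decide (R - (n + t) = swapCode n p) then 1 else 0))
  else 0

/-- The size `N = n + (t + n²)` of the slices. [cite: BlaserIkenmeyerLysikovPandeySchreyer2019, Thm. 34 (proof)] -/
abbrev dimB (n : ℕ) (forms : List (List ℤ)) : ℕ := n + (forms.length + n * n)

/-- The entry list of the output tensor: `n²` slices of size `N × N`, slice-major then row-major
(the input format of `HMinRank1`, `hmrTensorOfList`). [cite: BlaserIkenmeyerLysikovPandeySchreyer2019, Problem 2 (input)] -/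
def entriesB (n : ℕ) (forms : List (List ℤ)) : List ℤ :=
  (List.range (n * n * dimB n forms ^ 2)).map fun s =>
    sliceEntry n forms.length forms (s / dimB n forms ^ 2) (s / dimB n forms % dimB n forms) (s % dimB n forms)

/-- **The `HMinRank1` instance of an `HQuad_ℤ` instance** `(n, Q_1..Q_t)`: `(N, n², entries, 1)`.
[cite: BlaserIkenmeyerLysikovPandeySchreyer2019, Thm. 34 (proof)] -/
def instB (x : ℕ × List (List ℤ)) : ℕ × ℕ × List ℤ × ℕ := (dimB x.1 x.2, x.1 * x.1, entriesB x.1 x.2, 1)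

/-- The fixed no-instance of `HMinRank1` (bound `0 ≠ 1`). [cite: BlaserIkenmeyerLysikovPandeySchreyer2019, Problem 3] -/
def badB : ℕ × ℕ × List ℤ × ℕ := (0, 0, [], 0)

/-- The fixed yes-instance of `HMinRank1`: one (empty) slice, `x = 1` (`rk` of the empty matrix is
`0 ≤ 1`). [cite: BlaserIkenmeyerLysikovPandeySchreyer2019, Problem 3] -/
def yesB : ℕ × ℕ × List ℤ × ℕ := (0, 1, [], 1)

/-- The guard: every form has `n²` coefficients. [cite: BlaserIkenmeyerLysikovPandeySchreyer2019, Problem 4 (input)] -/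
def guardB (x : ℕ × List (List ℤ)) : Bool := x.2.all fun l => decide (l.length = x.1 ^ 2)

/-- **The instance map `HQuad_ℤ → HMinRank1`** on all instances (no forms: the answer is "`n ≥ 1`").
[cite: BlaserIkenmeyerLysikovPandeySchreyer2019, Thm. 34 (proof)] -/
def reduceB (x : ℕ × List (List ℤ)) : ℕ × ℕ × List ℤ × ℕ :=
  if guardB x then (if x.2.length = 0 then (if x.1 = 0 then badB else yesB) else instB x) else badB

/-! #### Index bookkeeping -/

variable {F}

/-- Row-major pair codes `(i, j) ↦ i n + j`. [folklore] -/
def pairIdx {n : ℕ} (i j : Fin n) : Fin (n * n) := ⟨i.1 * n + j.1, rowMajor_lt' i.2 j.2⟩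

/-- `0 < n` as soon as `[n²]` is inhabited. [folklore] -/
private theorem pos_of_fin {n : ℕ} (p : Fin (n * n)) : 0 < n :=
  Nat.pos_of_ne_zero fun h => by have := p.2; subst h; simp at this

/-- The first component `p / n` of a pair code. [folklore] -/
def divIdx {n : ℕ} (p : Fin (n * n)) : Fin n :=
  ⟨p.1 / n, (Nat.div_lt_iff_lt_mul (pos_of_fin p)).2 p.2⟩

/-- The second component `p mod n` of a pair code. [folklore] -/
def modIdx {n : ℕ} (p : Fin (n * n)) : Fin n := ⟨p.1 % n, Nat.mod_lt _ (pos_of_fin p)⟩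

/-- The transposed pair code, on `[n²]`. [folklore] -/
def swapIdx {n : ℕ} (p : Fin (n * n)) : Fin (n * n) :=
  ⟨swapCode n p.1, rowMajor_lt' (Nat.mod_lt _ (pos_of_fin p)) (Nat.div_lt_iff_lt_mul (pos_of_fin p) |>.2 p.2)⟩

/-- Decoding a pair code, first component. [folklore] -/
private theorem divIdx_pairIdx {n : ℕ} (i j : Fin n) : divIdx (pairIdx i j) = i :=
  Fin.ext (rowMajor_div_mod' j.2).1

/-- Decoding a pair code, second component. [folklore] -/
private theorem modIdx_pairIdx {n : ℕ} (i j : Fin n) : modIdx (pairIdx i j) = j :=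
  Fin.ext (rowMajor_div_mod' j.2).2

/-- Re-encoding a decoded pair code. [folklore] -/
private theorem pairIdx_divIdx_modIdx {n : ℕ} (p : Fin (n * n)) : pairIdx (divIdx p) (modIdx p) = p :=
  Fin.ext (Nat.div_add_mod' p.1 n)

/-- Transposing a pair code. [folklore] -/
private theorem swapIdx_pairIdx {n : ℕ} (i j : Fin n) : swapIdx (pairIdx i j) = pairIdx j i := by
  refine Fin.ext ?_
  simp only [swapIdx, swapCode, pairIdx, (rowMajor_div_mod' j.2).1, (rowMajor_div_mod' j.2).2]

/-- First component of a transposed code. [folklore] -/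
private theorem divIdx_swapIdx {n : ℕ} (p : Fin (n * n)) : divIdx (swapIdx p) = modIdx p := by
  rw [← pairIdx_divIdx_modIdx p, swapIdx_pairIdx, divIdx_pairIdx, modIdx_pairIdx]

/-- Second component of a transposed code. [folklore] -/
private theorem modIdx_swapIdx {n : ℕ} (p : Fin (n * n)) : modIdx (swapIdx p) = divIdx p := by
  rw [← pairIdx_divIdx_modIdx p, swapIdx_pairIdx, modIdx_pairIdx, divIdx_pairIdx]

/-- Transposition is an involution. [folklore] -/
private theorem swapIdx_swapIdx {n : ℕ} (p : Fin (n * n)) : swapIdx (swapIdx p) = p := by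
  rw [← pairIdx_divIdx_modIdx p, swapIdx_pairIdx, swapIdx_pairIdx]

/-- A sum over pair codes is a double sum. [folklore] -/
private theorem sum_pairIdx {n : ℕ} {M : Type*} [AddCommMonoid M] (g : Fin (n * n) → M) :
    ∑ p, g p = ∑ i : Fin n, ∑ j : Fin n, g (pairIdx i j) := by
  have he : ∀ x : Fin n × Fin n, finProdFinEquiv x = pairIdx x.1 x.2 := fun x => by
    refine Fin.ext ?_
    simp only [finProdFinEquiv_apply_val, pairIdx]
    ring
  rw [← Equiv.sum_comp finProdFinEquiv, Fintype.sum_prod_type]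
  simp only [he]

/-! #### The positions: `[N] ≃ [n] ⊕ ([t] ⊕ [n²])` -/

/-- The three blocks of positions: top-left `[n]`, the form diagonal `[t]`, the symmetry diagonal
`[n²]`. [cite: BlaserIkenmeyerLysikovPandeySchreyer2019, Thm. 34 (proof)] -/
def posEquiv (n : ℕ) (forms : List (List ℤ)) : Fin n ⊕ (Fin forms.length ⊕ Fin (n * n)) ≃ Fin (dimB n forms) :=
  (Equiv.sumCongr (Equiv.refl _) finSumFinEquiv).trans finSumFinEquiv

/-- Positions of the top-left block. [folklore] -/
private theorem posEquiv_inl {n : ℕ} {forms : List (List ℤ)} (a : Fin n) :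
    (posEquiv n forms (Sum.inl a)).1 = a.1 := by
  simp [posEquiv]

/-- Positions of the form diagonal. [folklore] -/
private theorem posEquiv_mid {n : ℕ} {forms : List (List ℤ)} (l : Fin forms.length) :
    (posEquiv n forms (Sum.inr (Sum.inl l))).1 = n + l.1 := by
  simp [posEquiv]

/-- Positions of the symmetry diagonal. [folklore] -/
private theorem posEquiv_last {n : ℕ} {forms : List (List ℤ)} (q : Fin (n * n)) :
    (posEquiv n forms (Sum.inr (Sum.inr q))).1 = n + (forms.length + q.1) := by
  simp [posEquiv]

/-- The two diagonal blocks lie beyond the top-left block. [folklore] -/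
private theorem le_posEquiv_inr {n : ℕ} {forms : List (List ℤ)} (w : Fin forms.length ⊕ Fin (n * n)) :
    n ≤ (posEquiv n forms (Sum.inr w)).1 := by
  rcases w with l | q
  · rw [posEquiv_mid]; omega
  · rw [posEquiv_last]; omega

/-! #### The slices -/

/-- Slice entries in the top-left block. [folklore] -/
private theorem sliceEntry_lt {n t : ℕ} (forms : List (List ℤ)) (p : ℕ) {R C : ℕ} (hR : R < n) (hC : C < n) :
    sliceEntry n t forms p R C = if R = p / n ∧ C = p % n then 1 else 0 := by
  simp [sliceEntry, hR, hC]

/-- Slice entries on the form diagonal. [folklore] -/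
private theorem sliceEntry_mid {n t : ℕ} (forms : List (List ℤ)) (p : ℕ) {l : ℕ} (hl : l < t) :
    sliceEntry n t forms p (n + l) (n + l) = (forms.getD l []).getD p 0 := by
  simp [sliceEntry, hl]

/-- Slice entries on the symmetry diagonal. [folklore] -/
private theorem sliceEntry_last {n t : ℕ} (forms : List (List ℤ)) (p q : ℕ) :
    sliceEntry n t forms p (n + (t + q)) (n + (t + q)) =
      (if q = p then 1 else 0) - (if q = swapCode n p then 1 else 0) := by
  have h1 : ¬ (n + (t + q) < n + t) := by omega
  have h2 : n + (t + q) - (n + t) = q := by omega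
  simp [sliceEntry, h1, h2]

/-- Slice entries vanish off the diagonal outside the top-left block. [folklore] -/
private theorem sliceEntry_offDiag {n t : ℕ} (forms : List (List ℤ)) (p : ℕ) {R C : ℕ} (hRC : R ≠ C)
    (h : n ≤ R ∨ n ≤ C) : sliceEntry n t forms p R C = 0 := by
  have h' : ¬ (R < n ∧ C < n) := by omega
  simp [sliceEntry, hRC, h']

/-! #### The pencil `Σ_p y_p · slice_p` -/

variable (F)

/-- **The pencil of the output instance at `y ∈ F^{n²}`**: the contraction `Ty = Σ_p y_p · slice_p`
(`contract3` of `hmrTensorOfList`). [cite: BlaserIkenmeyerLysikovPandeySchreyer2019, Thm. 34 (proof)] -/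
def pencilB (n : ℕ) (forms : List (List ℤ)) (y : Fin (n * n) → F) : Matrix (Fin (dimB n forms)) (Fin (dimB n forms)) F :=
  contract3 (hmrTensorOfList F (dimB n forms) (n * n) (entriesB n forms)) y

variable {F}

/-- Positions of the entry list decode. [folklore] -/
private theorem idx3 {N K : ℕ} (a : Fin K) (R C : Fin N) :
    a.1 * N ^ 2 + R.1 * N + C.1 < K * N ^ 2 ∧ (a.1 * N ^ 2 + R.1 * N + C.1) / N ^ 2 = a.1 ∧
      (a.1 * N ^ 2 + R.1 * N + C.1) / N % N = R.1 ∧ (a.1 * N ^ 2 + R.1 * N + C.1) % N = C.1 := by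
  set s := a.1 * N ^ 2 + R.1 * N + C.1 with hs
  have hs1 : s = (a.1 * N + R.1) * N + C.1 := by rw [hs]; ring
  have e1 : s / N = a.1 * N + R.1 ∧ s % N = C.1 := by rw [hs1]; exact rowMajor_div_mod' C.2
  have e2 : s / N ^ 2 = a.1 ∧ s / N % N = R.1 := by
    rw [sq, ← Nat.div_div_eq_div_mul, e1.1]; exact rowMajor_div_mod' R.2
  refine ⟨?_, e2.1, e2.2, e1.2⟩
  rw [hs1, sq, ← mul_assoc]
  exact rowMajor_lt' (rowMajor_lt' a.2 R.2) C.2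

/-- The entries of the pencil. [cite: BlaserIkenmeyerLysikovPandeySchreyer2019, Thm. 34 (proof)] -/
theorem pencilB_apply {n : ℕ} {forms : List (List ℤ)} (y : Fin (n * n) → F) (R C : Fin (dimB n forms)) :
    pencilB F n forms y R C = ∑ p : Fin (n * n), y p * (sliceEntry n forms.length forms p.1 R.1 C.1 : F) := by
  simp only [pencilB, contract3_apply, hmrTensorOfList]
  refine Finset.sum_congr rfl fun p _ => ?_
  obtain ⟨hs, e1, e2, e3⟩ := idx3 p R C
  rw [entriesB, getD_map_range' _ hs, e1, e2, e3]

/-- **Top-left block: the general matrix `Y`**, `Y_{ab} = y_{(a,b)}`. [cite: BlaserIkenmeyerLysikovPandeySchreyer2019, Thm. 34 (proof)] -/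
theorem pencilB_inl_inl {n : ℕ} {forms : List (List ℤ)} (y : Fin (n * n) → F) (a b : Fin n) :
    pencilB F n forms y (posEquiv n forms (Sum.inl a)) (posEquiv n forms (Sum.inl b)) = y (pairIdx a b) := by
  rw [pencilB_apply]
  simp_rw [posEquiv_inl, sliceEntry_lt forms _ a.2 b.2]
  rw [Finset.sum_eq_single (pairIdx a b)]
  · simp [pairIdx, (rowMajor_div_mod' b.2).1, (rowMajor_div_mod' b.2).2]
  · intro p _ hp
    have hne : ¬ (a.1 = p.1 / n ∧ b.1 = p.1 % n) := by
      rintro ⟨ha, hb⟩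
      apply hp
      rw [← pairIdx_divIdx_modIdx p]
      exact congrArg₂ pairIdx (Fin.ext ha.symm) (Fin.ext hb.symm)
    simp [hne]
  · simp

/-- **Form diagonal: `⟨Q_l, Y⟩ = Σ_p Q_l[p] y_p`** at position `n + l`. [cite: BlaserIkenmeyerLysikovPandeySchreyer2019, Thm. 34 (proof)] -/
theorem pencilB_mid {n : ℕ} {forms : List (List ℤ)} (y : Fin (n * n) → F) (l : Fin forms.length) :
    pencilB F n forms y (posEquiv n forms (Sum.inr (Sum.inl l))) (posEquiv n forms (Sum.inr (Sum.inl l))) =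
      ∑ p : Fin (n * n), y p * ((forms.getD l.1 []).getD p.1 0 : F) := by
  rw [pencilB_apply]
  simp_rw [posEquiv_mid, sliceEntry_mid forms _ l.2]

/-- **Symmetry diagonal: `y_q − y_{swap q}`** at position `n + t + q`. [cite: BlaserIkenmeyerLysikovPandeySchreyer2019, Thm. 34 (proof)] -/
theorem pencilB_last {n : ℕ} {forms : List (List ℤ)} (y : Fin (n * n) → F) (q : Fin (n * n)) :
    pencilB F n forms y (posEquiv n forms (Sum.inr (Sum.inr q))) (posEquiv n forms (Sum.inr (Sum.inr q))) =
      y q - y (swapIdx q) := by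
  rw [pencilB_apply]
  simp_rw [posEquiv_last, sliceEntry_last forms]
  simp only [Int.cast_sub, mul_sub, Finset.sum_sub_distrib]
  congr 1
  · rw [Finset.sum_eq_single q]
    · simp
    · intro p _ hp
      have : q.1 ≠ p.1 := fun h => hp (Fin.ext h).symm
      simp [this]
    · simp
  · rw [Finset.sum_eq_single (swapIdx q)]
    · have h : q.1 = swapCode n (swapIdx q).1 := (congrArg Fin.val (swapIdx_swapIdx q)).symm
      rw [if_pos h]
      simp
    · intro p _ hp
      have : q.1 ≠ swapCode n p.1 := by
        intro h
        apply hp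
        have h' : q = swapIdx p := Fin.ext h
        rw [h', swapIdx_swapIdx]
      simp [this]
    · simp

/-- **All other entries of the pencil vanish.** [cite: BlaserIkenmeyerLysikovPandeySchreyer2019, Thm. 34 (proof)] -/
theorem pencilB_offDiag {n : ℕ} {forms : List (List ℤ)} (y : Fin (n * n) → F) {R C : Fin (dimB n forms)}
    (hRC : R ≠ C) (h : n ≤ R.1 ∨ n ≤ C.1) : pencilB F n forms y R C = 0 := by
  rw [pencilB_apply]
  simp_rw [sliceEntry_offDiag forms _ (Fin.val_ne_of_ne hRC) h]
  simp

/-! #### (⇐): a common zero gives a rank-one pencil -/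

/-- The coefficient vector `y_{(i,j)} = v_i v_j` of a candidate `v ∈ Fⁿ`. [cite: BlaserIkenmeyerLysikovPandeySchreyer2019, Thm. 32 (proof: `x xᵀ`)] -/
def outerVec {n : ℕ} (v : Fin n → F) : Fin (n * n) → F := fun p => v (divIdx p) * v (modIdx p)

/-- `⟨Q, v vᵀ⟩ = Q(v)` (the quadratic form as a linear form on `x xᵀ`, Thm 32). [cite: BlaserIkenmeyerLysikovPandeySchreyer2019, Thm. 32 (proof)] -/
theorem sum_outerVec_eq_quadFormOfList {n : ℕ} (L : List ℤ) (v : Fin n → F) :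
    ∑ p : Fin (n * n), outerVec v p * ((L.getD p.1 0 : ℤ) : F) = quadFormOfList F n L v := by
  rw [sum_pairIdx, quadFormOfList]
  refine Finset.sum_congr rfl fun i _ => Finset.sum_congr rfl fun j _ => ?_
  simp only [outerVec]
  rw [divIdx_pairIdx, modIdx_pairIdx]
  simp only [pairIdx]
  ring

/-- **(⇐) The pencil at `y = (v_i v_j)` of a common zero `v` is `u uᵀ` with `u = (v, 0, 0)`**, hence
all its `2 × 2` minors vanish and its rank is `≤ 1`. [cite: BlaserIkenmeyerLysikovPandeySchreyer2019, Thm. 34 (proof)] -/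
theorem rank_pencilB_le_one_of_common_zero {n : ℕ} {forms : List (List ℤ)} (v : Fin n → F)
    (hv : ∀ l ∈ forms, quadFormOfList F n l v = 0) : (pencilB F n forms (outerVec v)).rank ≤ 1 := by
  classical
  set e := posEquiv n forms with he
  let u : Fin (dimB n forms) → F := fun R => Sum.elim v (fun _ => 0) (e.symm R)
  have key : ∀ R C, pencilB F n forms (outerVec v) R C = u R * u C := by
    intro R C
    obtain ⟨w, rfl⟩ := e.surjective R
    obtain ⟨w', rfl⟩ := e.surjective C
    simp only [u, Equiv.symm_apply_apply]
    rcases w with a | w <;> rcases w' with b | w'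
    · rw [he, pencilB_inl_inl]
      simp only [outerVec, divIdx_pairIdx, modIdx_pairIdx, Sum.elim_inl]
    · rw [pencilB_offDiag _ (fun h => by simpa using e.injective h) (Or.inr (le_posEquiv_inr w'))]
      simp
    · rw [pencilB_offDiag _ (fun h => by simpa using e.injective h) (Or.inl (le_posEquiv_inr w))]
      simp
    · simp only [Sum.elim_inr, mul_zero]
      by_cases hww : w = w'
      · subst hww
        rcases w with l | q
        · rw [he, pencilB_mid, sum_outerVec_eq_quadFormOfList]
          refine hv _ ?_
          rw [List.getD_eq_getElem _ _ l.2]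
          exact List.getElem_mem l.2
        · rw [he, pencilB_last]
          simp only [outerVec]
          rw [divIdx_swapIdx, modIdx_swapIdx]
          ring
      · exact pencilB_offDiag _ (fun h => hww (by simpa using e.injective h)) (Or.inl (le_posEquiv_inr w))
  rw [Literature.LinearAlgebra.Matrix.rank_le_iff_det_submatrix_eq_zero]
  intro r c
  rw [Matrix.det_fin_two]
  simp only [Matrix.submatrix_apply, key]
  ring

/-- `y = (v_i v_j)` is nonzero for `v ≠ 0` (`y_{(i,i)} = v_i²`). [cite: BlaserIkenmeyerLysikovPandeySchreyer2019, Thm. 32 (proof)] -/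
theorem outerVec_ne_zero {n : ℕ} {v : Fin n → F} (hv : v ≠ 0) : outerVec v ≠ 0 := by
  obtain ⟨i, hi⟩ := Function.ne_iff.1 hv
  refine Function.ne_iff.2 ⟨pairIdx i i, ?_⟩
  simp only [outerVec]
  rw [divIdx_pairIdx, modIdx_pairIdx, Pi.zero_apply]
  exact mul_ne_zero hi hi

/-! #### (⇒): a rank-one pencil gives a common zero -/

/-- **(⇒) A nonzero `y` with `rk(Σ_p y_p · slice_p) ≤ 1` yields a nontrivial common zero of the
forms** — row `a` of `Y` for an entry `Y_{ab} ≠ 0`: the `2 × 2` minors through `(a, b)` and a diagonal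
position kill every `⟨Q_l, Y⟩` and make `Y` symmetric, and the minors inside `Y` give
`Y_{ai} Y_{aj} = Y_{aa} Y_{ij}`, so `Q_l(row_a Y) = Y_{aa} ⟨Q_l, Y⟩ = 0`. [cite: BlaserIkenmeyerLysikovPandeySchreyer2019, Thm. 34 (proof)] -/
theorem exists_common_zero_of_rank_le_one {n : ℕ} {forms : List (List ℤ)} {y : Fin (n * n) → F}
    (hy : y ≠ 0) (hr : (pencilB F n forms y).rank ≤ 1) :
    ∃ v : Fin n → F, v ≠ 0 ∧ ∀ l ∈ forms, quadFormOfList F n l v = 0 := by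
  classical
  set M := pencilB F n forms y with hM
  set e := posEquiv n forms with he
  -- all `2 × 2` minors vanish
  have hmin : ∀ R R' C C' : Fin (dimB n forms), M R C * M R' C' - M R C' * M R' C = 0 := by
    intro R R' C C'
    have h := (Literature.LinearAlgebra.Matrix.rank_le_iff_det_submatrix_eq_zero M).1 hr ![R, R'] ![C, C']
    rw [Matrix.det_fin_two] at h
    simpa using h
  -- a nonzero entry `Y_{ab}` of the top-left block
  obtain ⟨p₀, hp₀⟩ := Function.ne_iff.1 hy
  set a := divIdx p₀ with ha
  set b := modIdx p₀ with hb
  have hY : ∀ i j : Fin n, M (e (Sum.inl i)) (e (Sum.inl j)) = y (pairIdx i j) := fun i j => by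
    rw [hM, he, pencilB_inl_inl]
  have hab : M (e (Sum.inl a)) (e (Sum.inl b)) ≠ 0 := by
    rw [hY, ha, hb, pairIdx_divIdx_modIdx]; exact hp₀
  -- every diagonal entry outside the top-left block vanishes
  have hdiag : ∀ w : Fin forms.length ⊕ Fin (n * n), M (e (Sum.inr w)) (e (Sum.inr w)) = 0 := by
    intro w
    have h := hmin (e (Sum.inl a)) (e (Sum.inr w)) (e (Sum.inl b)) (e (Sum.inr w))
    have h0 : M (e (Sum.inl a)) (e (Sum.inr w)) = 0 := by
      rw [hM, he]
      exact pencilB_offDiag y (fun h => by simpa using (posEquiv n forms).injective h) (Or.inr (le_posEquiv_inr w))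
    rw [h0, zero_mul, sub_zero] at h
    exact (mul_eq_zero.1 h).resolve_left hab
  -- symmetry of `Y`
  have hsymm : ∀ i j : Fin n, y (pairIdx i j) = y (pairIdx j i) := by
    intro i j
    have h := hdiag (Sum.inr (pairIdx i j))
    rw [hM, he, pencilB_last, swapIdx_pairIdx, sub_eq_zero] at h
    exact h
  -- the linear conditions `⟨Q_l, Y⟩ = 0`
  have hlin : ∀ l : Fin forms.length, ∑ p : Fin (n * n), y p * ((forms.getD l.1 []).getD p.1 0 : F) = 0 := by
    intro l
    have h := hdiag (Sum.inl l)
    rwa [hM, he, pencilB_mid] at h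
  -- the rank-one relations inside `Y`
  have hrel : ∀ i j : Fin n, y (pairIdx a i) * y (pairIdx a j) = y (pairIdx a a) * y (pairIdx i j) := by
    intro i j
    have h := hmin (e (Sum.inl a)) (e (Sum.inl i)) (e (Sum.inl a)) (e (Sum.inl j))
    rw [hY, hY, hY, hY, hsymm i a] at h
    linear_combination -h
  -- the common zero: row `a` of `Y`
  refine ⟨fun j => y (pairIdx a j), Function.ne_iff.2 ⟨b, ?_⟩, fun l hl => ?_⟩
  · rw [Pi.zero_apply, ha, hb, pairIdx_divIdx_modIdx]; exact hp₀
  · obtain ⟨k, hk, rfl⟩ := List.getElem_of_mem hl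
    have h := hlin ⟨k, hk⟩
    rw [sum_pairIdx] at h
    simp only [List.getD_eq_getElem _ _ hk] at h
    rw [quadFormOfList]
    calc ∑ i : Fin n, ∑ j : Fin n, ((forms[k].getD (i.1 * n + j.1) 0 : ℤ) : F) * y (pairIdx a i) * y (pairIdx a j)
        = y (pairIdx a a) * ∑ i : Fin n, ∑ j : Fin n, y (pairIdx i j) * ((forms[k].getD (pairIdx i j).1 0 : ℤ) : F) := by
          rw [Finset.mul_sum]
          refine Finset.sum_congr rfl fun i _ => ?_
          rw [Finset.mul_sum]
          refine Finset.sum_congr rfl fun j _ => ?_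
          rw [mul_assoc, hrel i j]
          simp only [pairIdx]
          ring
      _ = 0 := by rw [h, mul_zero]

/-! #### Correctness of the instance map -/

variable (F)

/-- The fixed instance `(0, 0, [], 0)` is a no-instance of `HMinRank1` (bound `0 ≠ 1`).
[cite: BlaserIkenmeyerLysikovPandeySchreyer2019, Problem 3] -/
theorem badB_not_mem : badB ∉ hmr1Set F := by
  rintro ⟨-, h, -⟩
  exact absurd h (by decide)

/-- The fixed instance `(0, 1, [], 1)` is a yes-instance of `HMinRank1` (`x = 1`, empty matrix).
[cite: BlaserIkenmeyerLysikovPandeySchreyer2019, Problem 3] -/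
theorem yesB_mem : yesB ∈ hmr1Set F := by
  refine ⟨by simp [yesB, HMRWellFormed], rfl, fun _ => 1, ?_, ?_⟩
  · exact Function.ne_iff.2 ⟨⟨0, by decide⟩, one_ne_zero⟩
  · exact (Matrix.rank_le_card_width _).trans (by simp [yesB])

/-- The guard decides the coefficient-length condition of `HQuad_ℤ`. [cite: BlaserIkenmeyerLysikovPandeySchreyer2019, Problem 4 (input)] -/
theorem guardB_eq_true_iff (x : ℕ × List (List ℤ)) : guardB x = true ↔ ∀ l ∈ x.2, l.length = x.1 ^ 2 := by
  simp [guardB, List.all_eq_true]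

/-- **Correctness of the instance map**: `(n, Q_1..Q_t)` has a nontrivial common zero over `F` iff
its image is a yes-instance of `HMinRank1` over `F`. [cite: BlaserIkenmeyerLysikovPandeySchreyer2019, Thm. 34 (proof)] -/
theorem mem_hquadZSet_iff_reduceB_mem (x : ℕ × List (List ℤ)) : x ∈ hquadZSet F ↔ reduceB x ∈ hmr1Set F := by
  obtain ⟨n, forms⟩ := x
  unfold reduceB
  by_cases hg : guardB (n, forms) = true
  · rw [if_pos hg]
    have hg' := (guardB_eq_true_iff (n, forms)).1 hg
    by_cases ht : forms.length = 0
    · rw [if_pos ht]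
      have hnil : forms = [] := List.eq_nil_of_length_eq_zero ht
      subst hnil
      by_cases hn : n = 0
      · rw [if_pos hn]
        subst hn
        refine ⟨fun ⟨_, v, hv, _⟩ => (hv (Subsingleton.elim _ _)).elim, fun h => (badB_not_mem F h).elim⟩
      · rw [if_neg hn]
        refine ⟨fun _ => yesB_mem F, fun _ => ⟨by simp, fun _ => 1, ?_, by simp⟩⟩
        exact Function.ne_iff.2 ⟨⟨0, Nat.pos_of_ne_zero hn⟩, one_ne_zero⟩
    · rw [if_neg ht]
      constructor
      · rintro ⟨-, v, hv, hzero⟩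
        exact ⟨by simp [instB, HMRWellFormed, entriesB], rfl, outerVec v, outerVec_ne_zero hv,
          rank_pencilB_le_one_of_common_zero v hzero⟩
      · rintro ⟨-, -, y, hy, hr⟩
        obtain ⟨v, hv, hzero⟩ := exists_common_zero_of_rank_le_one hy hr
        exact ⟨hg', v, hv, hzero⟩
  · rw [if_neg hg]
    refine ⟨fun ⟨h, _⟩ => (hg ((guardB_eq_true_iff (n, forms)).2 h)).elim, fun h => (badB_not_mem F h).elim⟩

end ReductionB

/-! ### §N. The machine: the instance map on codes, in the typed `CodeFP` algebra -/

section MachineB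

/-- The unary loop budget `(t + Σ_l |Q_l| + 2)⁴` (it dominates the number `n² N²` of entries when
`t ≥ 1` and every `|Q_l| = n²`). [cite: AroraBarak2009, §1.3 (polynomially bounded loops)] -/
def budgetB (x : ℕ × List (List ℤ)) : ℕ := (x.2.length + (x.2.map List.length).sum + 2) ^ 4

/-- The entry list tabulated under a budget `B` (equal to `entriesB` when `n² N² ≤ B`). [cite: AroraBarak2009, §1.3] -/
def entriesBC (n : ℕ) (forms : List (List ℤ)) (B : ℕ) : List ℤ :=
  (List.range (min (n * n * dimB n forms ^ 2) B)).map fun s =>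
    sliceEntry n forms.length forms (s / dimB n forms ^ 2) (s / dimB n forms % dimB n forms) (s % dimB n forms)

/-- The instance tabulated under a budget `B` (equal to `instB` under the guard, for `t ≥ 1` and
`B = budgetB`). [cite: AroraBarak2009, §1.3] -/
def instBC (x : ℕ × List (List ℤ)) (B : ℕ) : ℕ × ℕ × List ℤ × ℕ := (dimB x.1 x.2, x.1 * x.1, entriesBC x.1 x.2 B, 1)

/-- Under the guard and for `t ≥ 1` the budget dominates the loop bound, so the capped table is the
table. [folklore] -/
private theorem instBC_eq {x : ℕ × List (List ℤ)} (hg : guardB x = true) (ht : x.2.length ≠ 0) :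
    instBC x (budgetB x) = instB x := by
  obtain ⟨n, forms⟩ := x
  have hg' := (guardB_eq_true_iff (n, forms)).1 hg
  dsimp only at hg' ht
  set b := forms.length + (forms.map List.length).sum with hb
  have hnn : n * n ≤ b := by
    obtain ⟨l₀, hl₀⟩ := List.exists_mem_of_ne_nil forms (fun h => ht (by rw [h]; rfl))
    have h1 : l₀.length ≤ (forms.map List.length).sum :=
      List.single_le_sum (fun _ _ => Nat.zero_le _) _ (List.mem_map.2 ⟨l₀, hl₀, rfl⟩)
    rw [hg' l₀ hl₀, sq] at h1
    omega
  have hn : n ≤ b := (Nat.le_mul_self n).trans hnn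
  have ht' : forms.length ≤ b := by omega
  have hN : dimB n forms ≤ 3 * b := by rw [dimB]; omega
  have hB : n * n * dimB n forms ^ 2 ≤ budgetB (n, forms) := by
    have h9 : n * n * dimB n forms ^ 2 ≤ 9 * b ^ 3 :=
      calc n * n * dimB n forms ^ 2 ≤ b * (3 * b) ^ 2 := Nat.mul_le_mul hnn (Nat.pow_le_pow_left hN 2)
        _ = 9 * b ^ 3 := by ring
    have h3 : b ^ 3 ≤ b ^ 4 := by
      rcases Nat.eq_zero_or_pos b with h0 | hpos
      · simp [h0]
      · exact Nat.pow_le_pow_right hpos (by norm_num)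
    have e : (b + 2) ^ 4 = b ^ 4 + 8 * b ^ 3 + (24 * b ^ 2 + 32 * b + 16) := by ring
    have : budgetB (n, forms) = (b + 2) ^ 4 := by rw [budgetB, hb]
    rw [this, e]
    omega
  simp only [instBC, instB, entriesBC, entriesB, min_eq_left hB]

/-- The context of an entry: `((n, forms), s)` — instance and position. [cite: AroraBarak2009, §1.3] -/
abbrev bctxE : (ℕ × List (List ℤ)) × ℕ → List Bool := pairE quadE natE

/-- **The entry table on codes** (`sliceEntry` at the decoded position, read off the forms by nested
`rawGetOr`). [cite: BlaserIkenmeyerLysikovPandeySchreyer2019, Thm. 34 (proof)] [cite: AroraBarak2009, §1.3] -/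
theorem entryBFP : CodeFP bctxE smE (fun c => sliceEntry c.1.1 c.1.2.length c.1.2
    (c.2 / dimB c.1.1 c.1.2 ^ 2) (c.2 / dimB c.1.1 c.1.2 % dimB c.1.1 c.1.2) (c.2 % dimB c.1.1 c.1.2)) := by
  have hn : CodeFP bctxE natE (fun c => c.1.1) := (fst _ _).fst'
  have hF : CodeFP bctxE (rawE (listE smE)) (fun c => c.1.2) := ((rawOfList (listE smE)).comp (fst _ _).snd').congr fun _ => rfl
  have ht : CodeFP bctxE natE (fun c => c.1.2.length) := (natLength (listE smE)).comp hF
  have hs : CodeFP bctxE natE (fun c => c.2) := snd _ _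
  have hN : CodeFP bctxE natE (fun c => dimB c.1.1 c.1.2) :=
    (natAdd.comp (hn.pair (natAdd.comp (ht.pair (natMul.comp (hn.pair hn)))))).congr fun _ => rfl
  have hN2 : CodeFP bctxE natE (fun c => dimB c.1.1 c.1.2 ^ 2) := natPow.comp (hN.pair (const _ 2))
  have hp : CodeFP bctxE natE (fun c => c.2 / dimB c.1.1 c.1.2 ^ 2) := natDiv.comp (hs.pair hN2)
  have hR : CodeFP bctxE natE (fun c => c.2 / dimB c.1.1 c.1.2 % dimB c.1.1 c.1.2) :=
    natMod.comp ((natDiv.comp (hs.pair hN)).pair hN)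
  have hC : CodeFP bctxE natE (fun c => c.2 % dimB c.1.1 c.1.2) := natMod.comp (hs.pair hN)
  have hi : CodeFP bctxE natE (fun c => c.2 / dimB c.1.1 c.1.2 ^ 2 / c.1.1) := natDiv.comp (hp.pair hn)
  have hj : CodeFP bctxE natE (fun c => c.2 / dimB c.1.1 c.1.2 ^ 2 % c.1.1) := natMod.comp (hp.pair hn)
  have hnt : CodeFP bctxE natE (fun c => c.1.1 + c.1.2.length) := natAdd.comp (hn.pair ht)
  have hd : CodeFP bctxE natE (fun c => c.2 / dimB c.1.1 c.1.2 % dimB c.1.1 c.1.2 - (c.1.1 + c.1.2.length)) :=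
    natSub.comp (hR.pair hnt)
  have hsw : CodeFP bctxE natE (fun c => swapCode c.1.1 (c.2 / dimB c.1.1 c.1.2 ^ 2)) :=
    (natAdd.comp ((natMul.comp (hj.pair hn)).pair hi)).congr fun _ => rfl
  have c1 : CodeFP bctxE intE (fun _ => (1 : ℤ)) := const _ _
  have c0 : CodeFP bctxE intE (fun _ => (0 : ℤ)) := const _ _
  -- the coefficient `Q_{R-n}[p]`
  have hrow : CodeFP bctxE (rawE smE) (fun c => c.1.2.getD (c.2 / dimB c.1.1 c.1.2 % dimB c.1.1 c.1.2 - c.1.1) []) :=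
    ((rawOfList smE).comp ((rawGetOr (listE smE)).comp (hF.pair ((natSub.comp (hR.pair hn)).pair
      (const _ ([] : List ℤ)))))).congr fun _ => rfl
  have hQ : CodeFP bctxE intE (fun c => (c.1.2.getD (c.2 / dimB c.1.1 c.1.2 % dimB c.1.1 c.1.2 - c.1.1) []).getD
      (c.2 / dimB c.1.1 c.1.2 ^ 2) 0) :=
    (intOfSM.comp ((rawGetOr smE).comp (hrow.pair (hp.pair (const _ (0 : ℤ)))))).congr fun _ => rfl
  have v1 := ((natEq.comp (hR.pair hi)).and (natEq.comp (hC.pair hj))).ite c1 c0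
  have vS := intSub.comp (((natEq.comp (hd.pair hp)).ite c1 c0).pair ((natEq.comp (hd.pair hsw)).ite c1 c0))
  have h := ((natLt.comp (hR.pair hn)).and (natLt.comp (hC.pair hn))).ite v1
    ((natEq.comp (hR.pair hC)).ite ((natLt.comp (hR.pair hnt)).ite hQ vS) c0)
  exact (smOfInt.comp h).congr fun _ => rfl

/-- **The unary budget on codes** (`t` and `Σ_l |Q_l|` in unary, by `ulength` and `flatten`).
[cite: AroraBarak2009, §1.3] -/
theorem budgetBFP : CodeFP quadE (rawE unitE) (fun x => List.replicate (budgetB x) ()) := by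
  have hF : CodeFP quadE (rawE (listE smE)) (fun x => x.2) := ((rawOfList (listE smE)).comp (snd _ _)).congr fun _ => rfl
  have hT : CodeFP quadE unE (fun x => x.2.length) := (ulength (listE smE)).comp hF
  have hS : CodeFP quadE unE (fun x => (x.2.map List.length).sum) :=
    ((ulength smE).comp ((flatten smE).comp ((map₀ (rawOfList smE)).comp hF))).congr fun x => by
      simp [List.length_flatten]
  exact ((unitsPow 4).comp (unSucc.comp (unSucc.comp (unAdd.comp (hT.pair hS))))).congr fun _ => rfl

/-- **The capped instance on codes.** [cite: BlaserIkenmeyerLysikovPandeySchreyer2019, Thm. 34 (proof)] [cite: AroraBarak2009, §1.3] -/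
theorem instBCFP : CodeFP quadE instE (fun x => instBC x (List.replicate (budgetB x) ()).length) := by
  have hn : CodeFP quadE natE (fun x => x.1) := fst _ _
  have hF : CodeFP quadE (rawE (listE smE)) (fun x => x.2) := ((rawOfList (listE smE)).comp (snd _ _)).congr fun _ => rfl
  have ht : CodeFP quadE natE (fun x => x.2.length) := (natLength (listE smE)).comp hF
  have hN : CodeFP quadE natE (fun x => dimB x.1 x.2) :=
    (natAdd.comp (hn.pair (natAdd.comp (ht.pair (natMul.comp (hn.pair hn)))))).congr fun _ => rfl
  have hK : CodeFP quadE natE (fun x => x.1 * x.1) := natMul.comp (hn.pair hn)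
  have hKN2 : CodeFP quadE natE (fun x => x.1 * x.1 * dimB x.1 x.2 ^ 2) :=
    natMul.comp (hK.pair (natPow.comp (hN.pair (const _ 2))))
  have hrange : CodeFP quadE (rawE natE)
      (fun x => List.range (min (x.1 * x.1 * dimB x.1 x.2 ^ 2) (List.replicate (budgetB x) ()).length)) :=
    (brange unitE).comp (budgetBFP.pair hKN2)
  have hentries : CodeFP quadE (listE smE) (fun x => entriesBC x.1 x.2 (List.replicate (budgetB x) ()).length) :=
    ((listOfRaw smE).comp ((CodeFP.map entryBFP).comp ((CodeFP.id _).pair hrange))).congr fun _ => rfl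
  exact (hN.pair (hK.pair (hentries.pair (const _ 1)))).congr fun _ => rfl

/-- **The guard on codes.** [cite: BlaserIkenmeyerLysikovPandeySchreyer2019, Problem 4 (input)] [cite: AroraBarak2009, §1.3] -/
theorem guardBFP : CodeFP quadE bitE guardB := by
  have hn : CodeFP quadE natE (fun x => x.1) := fst _ _
  have hF : CodeFP quadE (rawE (listE smE)) (fun x => x.2) := ((rawOfList (listE smE)).comp (snd _ _)).congr fun _ => rfl
  have hp : CodeFP (pairE natE (listE smE)) bitE (fun c => decide (c.2.length = c.1 ^ 2)) :=
    natEq.comp (((natLength smE).comp (((rawOfList smE).comp (snd _ _)).congr fun _ => rfl)).pair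
      (natPow.comp ((fst _ _).pair (const _ 2))))
  exact ((CodeFP.all hp).comp (hn.pair hF)).congr fun _ => rfl

/-- **The instance map `reduceB` is computed on codes by a polynomial-time string function.**
[cite: BlaserIkenmeyerLysikovPandeySchreyer2019, Thm. 34] [cite: AroraBarak2009, §1.3] -/
theorem reduceBFP : CodeFP quadE instE reduceB := by
  have hn : CodeFP quadE natE (fun x => x.1) := fst _ _
  have ht : CodeFP quadE natE (fun x => x.2.length) :=
    (natLength (listE smE)).comp (((rawOfList (listE smE)).comp (snd _ _)).congr fun _ => rfl)
  refine ((guardBFP.ite (((natEq.comp (ht.pair (const _ 0))).ite ((natEq.comp (hn.pair (const _ 0))).ite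
    (const _ badB) (const _ yesB)) instBCFP)) (const _ badB)).congr fun x => ?_)
  unfold reduceB
  by_cases hg : guardB x = true
  · rw [if_pos hg, if_pos hg]
    by_cases h0 : x.2.length = 0
    · simp [h0]
    · rw [decide_eq_false h0, List.length_replicate, instBC_eq hg h0]
      simp [h0]
  · rw [if_neg hg, if_neg hg]

end MachineB

/-! ### §T. `HQuad_ℤ ≤ₚ HMinRank1` and the discharge of `BILPS2019_thm34` -/

section ResultB

variable (F : Type u) [Field F]

/-- **BILPS Thm 34, second reduction: `HQuad_{ℤ,F} ≤ₚ HMinRank1_{ℤ,F}`** for every field `F` — by the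
elimination-free map of this file (module docstring: NOT the printed kernel-basis map of Thm 32/34,
which needs exact linear algebra over the effective field), non-codes going to a fixed non-member.
[cite: BlaserIkenmeyerLysikovPandeySchreyer2019, Thm. 34] -/
theorem hquadZLanguage_karpReducible_hmr1Language : hquadZLanguage F ≤ₚ hmr1Language F := by
  rw [hmr1Language_eq, hquadZLanguage_eq]
  refine karpReducible_of_decoder hquadInstEncoding tensorInstEncoding (dec := decQ) (fun x => ?_) ?_
    (g := reduceB) ?_ (mem_hquadZSet_iff_reduceB_mem F) (badB_not_mem F)
  · rw [quadE_eq]; exact decQ_quadE x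
  · rw [quadE_eq]; exact decQ_codeFP
  · rw [instE_eq, quadE_eq]; exact reduceBFP

end ResultB

end BILPS19Thm34

section Discharge

variable (F : Type u) [Field F]

/-- **Discharge of `BILPS2019_thm34`** (BILPS Thm 34: "Let `F` be a field and `K` be an effective
subfield of `F`. Then `HMinRank1_{K,F}` is polynomial-time equivalent to `HQuad_{K,F}`", typed as two
Karp reductions between the integer-entry problems): `HMinRank1 ≤ₚ HQuad_ℤ` by the printed
`2 × 2`-minors map (`BILPS19Thm34.hmr1Language_karpReducible_hquadZLanguage`, sibling file) and
`HQuad_ℤ ≤ₚ HMinRank1` by the elimination-free symmetric-pencil map of this file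
(`BILPS19Thm34.hquadZLanguage_karpReducible_hmr1Language`; the printed route instead outputs a
kernel basis, see the module docstring); every field `F`. [cite: BlaserIkenmeyerLysikovPandeySchreyer2019, Thm. 34] -/
theorem BILPS2019_thm34_holds : BILPS2019_thm34 F :=
  ⟨BILPS19Thm34.hmr1Language_karpReducible_hquadZLanguage F,
    BILPS19Thm34.hquadZLanguage_karpReducible_hmr1Language F⟩

end Discharge

end Literature.Barriers.ValiantsHypothesis
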